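import Mathlib
import Literature.NumberTheory.LFunctions.Zhang2022.Section16ResidueEstimates
import Literature.NumberTheory.LFunctions.Zhang2022.Section15ResidueProducts
import Literature.NumberTheory.LFunctions.Zhang2022.Section5Lemma54Discharge
import HarnessLib

/-!
# Zhang (2022) §16 p. 95, `Z22:§16.u043`–`u044` discharged modulo Lemma 5.4 (ii): `ℛ₂₂`, and assembly

Topic `Literature/NumberTheory/LFunctions/Zhang2022` (Landau–Siegel audit tree; verdict-neutral).
Y. Zhang, *Discrete mean estimates and the Landau–Siegel zero*, arXiv:2211.02515v1 (2022)
[Zhang2022LandauSiegel] — **an unrefereed manuscript under adjudication** (cell siegel-zhang, D-0069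
width campaign). DISCHARGE file (theorems only; no new definitions, no new facts); no statement about
Theorems 1–2 of the manuscript or about Landau–Siegel zeros is made or implied.

* `calR2_two_estimate`: `ℛ₂₂ = −1/(β₁L′(1,χ)) + O(𝓛⁶)` (§16 p. 95, `j = 2`; the pole of (16.11) at
  `s = −β₂` comes from `1/(s+β₂)`): from the closed form `calR2_two_eq`, `ℛ₂₂ = N·q·Z_u·Z₂⁻¹·Λ₂⁻¹` with
  `N = −1/(β₁L′)`, `q = (−β₁)/(β₁−β₂) = (1−5e)/(1+7e)`, `Z_u = uζ(1+u)` (`u = β₁−β₂`),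
  `Z₂ = (−β₂)ζ(1−β₂)`, `Λ₂ = L(1−β₂,χ)/(−β₂L′)`, each factor `1 + O(𝓛⁻⁶)`.
* `step16_u043_of_lemma54 : Skeleton.Lemma54 → Typed.Section16B.Step16_u043 c′` — DAG `Z22:§16.u043`
  [Z22 p.95, tex L4674–L4677] from Lemma 5.4 (ii) (CLAIM node `Skeleton.Lemma54`, hypothesis) and tree
  theorems only (Lemma 5.8 `Lemma58.lemma_5_8_of_le`, Lemma 5.7, Mathlib's `riemannZeta_residue_one`,
  `riemannZeta₁`).
* `step16_u044_of_lemma54 : Skeleton.Lemma54 → Typed.Section16B.Step16_u044 c′` — DAG `Z22:§16.u044`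
  via the kernel edge `step16_u044_of` (`Section15ResidueProducts`).
* `step16_u043_holds`, `step16_u044_holds` — UNCONDITIONAL (under the standing (A)-quantifier of the
  nodes): Lemma 5.4 is a theorem of the tree (`Skeleton.lemma54_holds`, `Section5Lemma54Discharge`).
-/

noncomputable section

open Complex Real Filter Topology

namespace Literature.NumberTheory.LFunctions.Zhang2022.ResidueValues

open Skeleton Typed.Section16A Typed.Section16B

variable (c' : ℝ)

/-- The algebra behind `ℛ₂₂ = N·q·Z_u·Z₂⁻¹·Λ₂⁻¹`: for non-zero `b₁, b₂, L, u, z₂, l`,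
`ζ/(z₂l) + 1/(b₁L) = (−1/(b₁L))·(((−b₁)/u)·(uζ)·((−b₂)z₂)⁻¹·(l/((−b₂)L))⁻¹ − 1)`.
[cite: Zhang2022LandauSiegel, §16 p. 95] -/
theorem residue_identity_two {b₁ b₂ L u z₂ l ζ : ℂ} (hb₁ : b₁ ≠ 0) (hb₂ : b₂ ≠ 0) (hL : L ≠ 0)
    (hu : u ≠ 0) (hz : z₂ ≠ 0) (hl : l ≠ 0) :
    ζ / (z₂ * l) + 1 / (b₁ * L) =
      -1 / (b₁ * L) * (-b₁ / u * (u * ζ) * (-b₂ * z₂)⁻¹ * (l / (-b₂ * L))⁻¹ - 1) := by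
  field_simp
  ring

/-- **`ℛ₂₂ = −1/(β₁L′(1,χ)) + O(𝓛⁶)`** (§16 p. 95, second half of `Z22:§16.u043`, `j = 2`), in fact
`O(𝓛³)`. [cite: Zhang2022LandauSiegel, §16 p. 95] -/
theorem calR2_two_estimate :
    ∃ C : ℝ, 0 ≤ C ∧ ForAllLarge fun D _ χ => AssumptionA D χ →
      ‖calR2 c' χ 2 + 1 / (beta1 c' D * deriv χ.LFunction 1)‖ ≤ C * ell D ^ 6 := by
  obtain ⟨c, hc, h57⟩ := norm_deriv_LFunction_one_ge
  obtain ⟨r, hr, K, hK, hζ⟩ := zeta_shift_bounds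
  obtain ⟨CL, hCL0, hLb⟩ := L_one_sub_beta_bounds
  obtain ⟨D₀, hall⟩ := h57.and hLb
  set Ktot : ℝ := 8 * (24 * (|c'| * π)) + 6 * (16 * K * π) + 2 * CL with hKtot
  have hKtot0 : 0 ≤ Ktot := by positivity
  refine ⟨2 / (π * c) * Ktot, by positivity,
    max D₀ (max (max ⌈Real.exp 3⌉₊ ⌈Real.exp (14 * |c'| * π)⌉₊)
      (max ⌈Real.exp (8 * π / r + 1)⌉₊ ⌈Real.exp (16 * K * π + 1)⌉₊)), fun D _ χ hD hq hp hA => ?_⟩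
  have hD₀ : D₀ ≤ D := le_trans (le_max_left _ _) hD
  have hD1 := le_trans (le_trans (le_max_left _ _) (le_max_right _ _)) hD
  have hD2 := le_trans (le_trans (le_max_left _ _) (le_trans (le_max_right _ _) (le_max_right _ _))) hD
  have hD3 := le_trans (le_trans (le_max_right _ _) (le_trans (le_max_right _ _) (le_max_right _ _))) hD
  obtain ⟨hL, he⟩ := thresholds c' hD1
  have hℓ : 0 < ell D := by linarith
  have hℓ1 : 1 ≤ ell D := by linarith
  have hα := alpha_pos hL
  have hαeq := Section2.alpha_eq_pi_div_ell9 D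
  have hαℓ9 : alpha D * ell D ^ 9 = π := by rw [hαeq]; field_simp
  have hlogD2 : 8 * π / r + 1 ≤ ell D := by
    have h : Real.exp (8 * π / r + 1) ≤ D := le_trans (Nat.le_ceil _) (by exact_mod_cast hD2)
    exact (Real.le_log_iff_exp_le (lt_of_lt_of_le (Real.exp_pos _) h)).mpr h
  have hlogD3 : 16 * K * π + 1 ≤ ell D := by
    have h : Real.exp (16 * K * π + 1) ≤ D := le_trans (Nat.le_ceil _) (by exact_mod_cast hD3)
    exact (Real.le_log_iff_exp_le (lt_of_lt_of_le (Real.exp_pos _) h)).mpr h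
  have h8α : 8 * alpha D < r := by
    have h1 : alpha D ≤ π / ell D := alpha_le hL
    have h2 : 8 * π / r < ell D := by linarith
    calc 8 * alpha D ≤ 8 * (π / ell D) := by linarith
      _ = (8 * π / r) * (r / ell D) := by field_simp
      _ < ell D * (r / ell D) := by gcongr
      _ = r := by field_simp
  -- `8Kα ≤ 1/2`
  have hK8α : K * (8 * alpha D) ≤ 1 / 2 := by
    calc K * (8 * alpha D) ≤ K * (8 * (π / ell D)) := by gcongr; exact alpha_le hL
      _ = 8 * K * π / ell D := by ring
      _ ≤ 1 / 2 := by
          rw [div_le_iff₀ hℓ]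
          nlinarith [mul_nonneg hK Real.pi_pos.le]
  obtain ⟨g57, gL⟩ := hall D χ hD₀ hq hp
  clear hall
  have hcL := g57 hA
  clear g57
  set L1 : ℂ := deriv χ.LFunction 1 with hL1
  have hN : 0 < ‖L1‖ := lt_of_lt_of_le hc hcL
  have hL0 : L1 ≠ 0 := fun h => by rw [h, norm_zero] at hN; exact lt_irrefl _ hN
  have hχ1 : χ ≠ 1 := by
    have hD1' : D ≠ 1 := by
      rintro rfl; norm_num [ell] at hL
    exact GammaFactor.ne_one_of_isPrimitive hp hD1'
  -- sizes of the shifts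
  have he' := abs_le.mp he
  obtain ⟨hβ1l, hβ2l, -⟩ := norm_beta_ge c' hL he
  have hβ1u := norm_beta1_le c' hL he
  have hβ2u := norm_beta2_le c' hL he
  obtain ⟨⟨h21l, h21u⟩, -, -⟩ := norm_beta_sub c' hL he
  have hβ1ne : beta1 c' D ≠ 0 := fun h => by rw [h, norm_zero] at hβ1l; linarith
  have hβ2ne : beta2 c' D ≠ 0 := fun h => by rw [h, norm_zero] at hβ2l; linarith
  have h12ne : beta1 c' D - beta2 c' D ≠ 0 := by
    intro h; apply (fun h' => by rw [h', norm_zero] at h21l; linarith : beta2 c' D - beta1 c' D ≠ 0)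
    linear_combination -h
  have h12u : ‖beta1 c' D - beta2 c' D‖ ≤ 8 * alpha D := by rw [norm_sub_rev]; exact h21u
  have hP := P4_pos hL
  -- the `ζ` factors: `Z_u = uζ(1+u)`, `u = β₁−β₂`, and `Z₂ = (−β₂)ζ(1−β₂)`
  have hu : ‖beta1 c' D - beta2 c' D‖ < r := lt_of_le_of_lt h12u h8α
  obtain ⟨-, hZu1, -⟩ := hζ (beta1 c' D - beta2 c' D) h12ne hu
  have hu2 : ‖-beta2 c' D‖ < r := by rw [norm_neg]; linarith
  obtain ⟨hζne, hZ21, hZ2half⟩ := hζ (-beta2 c' D) (neg_ne_zero.mpr hβ2ne) hu2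
  clear hζ
  have hζne' : riemannZeta (1 - beta2 c' D) ≠ 0 := by rw [sub_eq_add_neg]; exact hζne
  set Zu : ℂ := (beta1 c' D - beta2 c' D) * riemannZeta (1 + (beta1 c' D - beta2 c' D)) with hZudef
  have tZu : ‖Zu - 1‖ ≤ 16 * K * π / ell D ^ 9 := by
    calc ‖Zu - 1‖ ≤ K * ‖beta1 c' D - beta2 c' D‖ := hZu1
      _ ≤ K * (8 * alpha D) := by gcongr
      _ = 8 * K * π / ell D ^ 9 := by rw [hαeq]; ring
      _ ≤ 16 * K * π / ell D ^ 9 := by gcongr; nlinarith [mul_nonneg hK Real.pi_pos.le]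
  set Z2 : ℂ := -beta2 c' D * riemannZeta (1 - beta2 c' D) with hZ2def
  have hZ21' : ‖Z2 - 1‖ ≤ K * ‖-beta2 c' D‖ := by rw [hZ2def, sub_eq_add_neg]; exact hZ21
  have hZ2half' : ‖Z2 - 1‖ ≤ 1 / 2 := by rw [hZ2def, sub_eq_add_neg]; exact hZ2half
  have tZ2 : ‖Z2⁻¹ - 1‖ ≤ 16 * K * π / ell D ^ 9 := by
    have h := norm_inv_sub_one_le hZ21' (by
      calc K * ‖-beta2 c' D‖ ≤ K * (8 * alpha D) := by rw [norm_neg]; gcongr; linarith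
        _ ≤ 1 / 2 := hK8α)
    calc ‖Z2⁻¹ - 1‖ ≤ 2 * (K * ‖-beta2 c' D‖) := h
      _ ≤ 2 * (K * (4 * alpha D)) := by rw [norm_neg]; gcongr
      _ = 8 * K * π / ell D ^ 9 := by rw [hαeq]; ring
      _ ≤ 16 * K * π / ell D ^ 9 := by gcongr; nlinarith [mul_nonneg hK Real.pi_pos.le]
  have tZ1 : 16 * K * π / ell D ^ 9 ≤ 1 := by
    rw [div_le_one (pow_pos hℓ 9)]
    calc 16 * K * π ≤ ell D := by linarith
      _ = ell D ^ 1 := (pow_one _).symm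
      _ ≤ ell D ^ 9 := pow_le_pow_right₀ hℓ1 (by norm_num)
  -- the `L` factor `Λ₂ = L(1−β₂)/(−β₂L′)`
  obtain ⟨hLne, hΛ, hΛhalf⟩ := gL hA (beta2 c' D) hβ2l hβ2u
  clear gL
  set Λ : ℂ := χ.LFunction (1 - beta2 c' D) / (-beta2 c' D * L1) with hΛdef
  have tΛ : ‖Λ⁻¹ - 1‖ ≤ 2 * (CL / ell D ^ 6) := norm_inv_sub_one_le hΛ hΛhalf
  have tΛ1 : 2 * (CL / ell D ^ 6) ≤ 1 := by linarith
  -- the main factor `q = (−β₁)/(β₁−β₂) = (1−5e)/(1+7e)`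
  have h7 : (1 + 7 * (c' * alpha D * ell D) : ℝ) ≠ 0 := by
    intro h; have := he'.1; linarith
  set q : ℂ := -beta1 c' D / (beta1 c' D - beta2 c' D) with hqdef
  have hq : q = (((1 - 5 * (c' * alpha D * ell D)) / (1 + 7 * (c' * alpha D * ell D)) : ℝ) : ℂ) := by
    rw [hqdef, beta1_eq, beta2_eq]
    have h7c : ((1 + 7 * (c' * alpha D * ell D) : ℝ) : ℂ) ≠ 0 := Complex.ofReal_ne_zero.mpr h7
    have hαc : ((alpha D : ℝ) : ℂ) ≠ 0 := Complex.ofReal_ne_zero.mpr hα.ne'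
    push_cast at h7c ⊢
    have hden : I * (↑(alpha D) * (1 - 5 * (↑c' * ↑(alpha D) * ↑(ell D)))) -
        I * (↑(alpha D) * (2 + 2 * (↑c' * ↑(alpha D) * ↑(ell D)))) =
        -(I * ↑(alpha D)) * (1 + 7 * (↑c' * ↑(alpha D) * ↑(ell D))) := by ring
    rw [hden]
    field_simp
  have tq : ‖q - 1‖ ≤ 24 * |c' * alpha D * ell D| := by
    rw [hq, ← Complex.ofReal_one, ← Complex.ofReal_sub, Complex.norm_real, Real.norm_eq_abs]
    exact abs_ratio15_sub_one_le he
  -- the closed form and the identity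
  have hval := calR2_two_eq c' χ hχ1 hP h12ne hβ2ne hζne' hLne
  rw [sub_self, Complex.cpow_zero, one_mul] at hval
  have hω0 : GaussWeight.omega1 (ell D ^ 30) 0 = 1 := by simp [GaussWeight.omega1]
  rw [hω0, mul_one] at hval
  set N : ℂ := -1 / (beta1 c' D * L1) with hNdef
  have hid : calR2 c' χ 2 + 1 / (beta1 c' D * L1) = N * (q * Zu * Z2⁻¹ * Λ⁻¹ - 1) := by
    rw [hval]
    have h := residue_identity_two (ζ := riemannZeta (1 + beta1 c' D - beta2 c' D)) hβ1ne hβ2ne hL0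
      h12ne hζne' hLne
    rw [h, hNdef, hqdef, hZudef, hZ2def, hΛdef, add_sub_assoc]
  rw [hid, norm_mul]
  have hNb : ‖N‖ ≤ 2 / (π * c) * ell D ^ 9 := by
    rw [hNdef, norm_div, norm_neg, norm_one, norm_mul]
    have hden : alpha D / 2 * c ≤ ‖beta1 c' D‖ * ‖L1‖ := mul_le_mul hβ1l hcL hc.le (norm_nonneg _)
    calc 1 / (‖beta1 c' D‖ * ‖L1‖) ≤ 1 / (alpha D / 2 * c) :=
          one_div_le_one_div_of_le (by positivity) hden
      _ = 2 / (π * c) * ell D ^ 9 := by rw [hαeq]; field_simp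
  have hprod : ‖q * Zu * Z2⁻¹ * Λ⁻¹ - 1‖ ≤
      2 * (2 * (2 * (24 * |c' * alpha D * ell D|) + 16 * K * π / ell D ^ 9) + 16 * K * π / ell D ^ 9) +
        2 * (CL / ell D ^ 6) := by
    have s1 := norm_mul_sub_one_le tq tZu tZ1
    have s2 := norm_mul_sub_one_le s1 tZ2 tZ1
    exact norm_mul_sub_one_le s2 tΛ tΛ1
  have h1 : |c' * alpha D * ell D| = |c'| * π / ell D ^ 8 := abs_e_eq c' hL
  have hsmall : 2 * (2 * (2 * (24 * |c' * alpha D * ell D|) + 16 * K * π / ell D ^ 9) +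
      16 * K * π / ell D ^ 9) + 2 * (CL / ell D ^ 6) ≤ Ktot / ell D ^ 6 := by
    have p6 : (0 : ℝ) < ell D ^ 6 := pow_pos hℓ 6
    have i1 : |c' * alpha D * ell D| ≤ |c'| * π / ell D ^ 6 := by
      rw [h1]; exact div_le_div_of_nonneg_left (by positivity) p6 (pow_le_pow_right₀ hℓ1 (by norm_num))
    have i4 : 16 * K * π / ell D ^ 9 ≤ 16 * K * π / ell D ^ 6 :=
      div_le_div_of_nonneg_left (by positivity) p6 (pow_le_pow_right₀ hℓ1 (by norm_num))
    rw [hKtot]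
    have eq : (8 * (24 * (|c'| * π)) + 6 * (16 * K * π) + 2 * CL) / ell D ^ 6 =
        8 * (24 * (|c'| * π / ell D ^ 6)) + 6 * (16 * K * π / ell D ^ 6) + 2 * (CL / ell D ^ 6) := by
      field_simp
    rw [eq]
    linarith only [i1, i4, hCL0, hK, Real.pi_pos]
  calc ‖N‖ * ‖q * Zu * Z2⁻¹ * Λ⁻¹ - 1‖ ≤ (2 / (π * c) * ell D ^ 9) * (Ktot / ell D ^ 6) := by
        refine mul_le_mul hNb (hprod.trans hsmall) (norm_nonneg _) (by positivity)
    _ = 2 / (π * c) * Ktot * ell D ^ 3 := by field_simp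
    _ ≤ 2 / (π * c) * Ktot * ell D ^ 6 :=
        mul_le_mul_of_nonneg_left (pow_le_pow_right₀ hℓ1 (by norm_num : 3 ≤ 6))
          (mul_nonneg (div_nonneg (by norm_num) (mul_pos Real.pi_pos hc).le) hKtot0)

/-! ## Assembly: `Z22:§16.u043` and `Z22:§16.u044` modulo Lemma 5.4 (ii) -/

/-- **`Z22:§16.u043` ⇐ Lemma 5.4 (ii)** (§16 p. 95, tex L4674–L4677: "by Lemma 5.8 and direct
calculation, `ℛ₂* = β₁ + O(1/𝓛¹⁰)`, `ℛ₂ⱼ = −1/(β₁L′(1,χ)) + O(𝓛⁶)`, `j = 1, 2`"), for the concrete typed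
objects `Section16A.calR2star`, `Section16A.calR2`; the only hypothesis is the CLAIM node `Skeleton.Lemma54`
(Lemma 5.4 (ii), `δ(1) = 1 + O(α log 𝓛)`), Lemma 5.8 / 5.7 being theorems of the tree.
[cite: Zhang2022LandauSiegel, §16 p. 95] -/
theorem step16_u043_of_lemma54 (h54 : Lemma54) : Step16_u043 c' := by
  obtain ⟨C₀, hC₀, h0⟩ := calR2star_estimate c' h54
  obtain ⟨C₁, hC₁, h1⟩ := calR2_one_estimate c'
  obtain ⟨C₂, hC₂, h2⟩ := calR2_two_estimate c'
  obtain ⟨D₀, hall⟩ := (h0.and h1).and h2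
  refine ⟨max C₀ (max C₁ C₂), D₀, fun D _ χ hD hq hp hA => ?_⟩
  obtain ⟨⟨g0, g1⟩, g2⟩ := hall D χ hD hq hp
  have hℓ0 : 0 ≤ ell D := Real.log_natCast_nonneg D
  refine ⟨(g0 hA).trans ?_, fun j hj => ?_⟩
  · gcongr; exact le_max_left _ _
  · simp only [Finset.mem_insert, Finset.mem_singleton] at hj
    rcases hj with rfl | rfl
    · exact (g1 hA).trans (by gcongr; exact le_trans (le_max_left _ _) (le_max_right _ _))
    · exact (g2 hA).trans (by gcongr; exact le_trans (le_max_right _ _) (le_max_right _ _))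

/-- **`Z22:§16.u044` ⇐ Lemma 5.4 (ii)** (§16 p. 95, tex L4678–L4681: "so that
`ℛ₂*ℛ₂ⱼ = −1/L′(1,χ) + O(𝓛⁻¹L′(1,χ)⁻¹)`"), by the kernel edge `step16_u044_of`.
[cite: Zhang2022LandauSiegel, §16 p. 95] -/
theorem step16_u044_of_lemma54 (h54 : Lemma54) : Step16_u044 c' :=
  step16_u044_of c' (step16_u043_of_lemma54 c' h54)

/-- **`Z22:§16.u043` HOLDS** (§16 p. 95): the typed node `Typed.Section16B.Step16_u043 c′` is a theorem,
for every `c′` — Lemma 5.4 being the tree's `Skeleton.lemma54_holds`. [cite: Zhang2022LandauSiegel, §16 p. 95] -/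
theorem step16_u043_holds : Step16_u043 c' := step16_u043_of_lemma54 c' lemma54_holds

/-- `Step16_u043` — `_holds` alias of `step16_u043_holds` above under the fact's exact name (appended
2026-08-28, D-0026 bookkeeping: the proof term is the existing theorem of this file; no statement,
definition or attribute is edited; no new named fact; the ledger's debt table listed the fact
unproved). [cite: Zhang2022LandauSiegel, §16 p. 95] -/
theorem _root_.Literature.NumberTheory.LFunctions.Zhang2022.Typed.Section16B.Step16_u043_holds :
    Step16_u043 c' :=
  _root_.Literature.NumberTheory.LFunctions.Zhang2022.ResidueValues.step16_u043_holds (c' := c')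

/-- **`Z22:§16.u044` HOLDS** (§16 p. 95): `ℛ₂*ℛ₂ⱼ = −1/L′(1,χ) + O(𝓛⁻¹L′(1,χ)⁻¹)` for the typed objects,
for every `c′`. [cite: Zhang2022LandauSiegel, §16 p. 95] -/
theorem step16_u044_holds : Step16_u044 c' := step16_u044_of_lemma54 c' lemma54_holds

/-- `Step16_u044` — `_holds` alias of `step16_u044_holds` above under the fact's exact name (appended
2026-08-28, D-0026 bookkeeping: the proof term is the existing theorem of this file; no statement,
definition or attribute is edited; no new named fact; the ledger's debt table listed the fact
unproved). [cite: Zhang2022LandauSiegel, §16 p. 95] -/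
theorem _root_.Literature.NumberTheory.LFunctions.Zhang2022.Typed.Section16B.Step16_u044_holds :
    Step16_u044 c' :=
  _root_.Literature.NumberTheory.LFunctions.Zhang2022.ResidueValues.step16_u044_holds (c' := c')

end Literature.NumberTheory.LFunctions.Zhang2022.ResidueValues
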